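import Literature.NumberTheory.EllipticCurves.DeShalit1987.LMeasureExistence
import HarnessLib

/-!
# de Shalit 1987, II.4.16–4.17: the Katz object `G(λ; T₁, T₂)` of an integral measure on `𝒢 = Gal(K(𝔣p^∞)/K)`
# and ITS VALUE AT A CHARACTER POINT — inside the interpolation cone or OUTSIDE it

One source section — E. de Shalit (1987), II §4.16 (49)–(50), §4.17 (52)–(54) — in the tree's measure currency
(`GroupDistribution`, `katzDistribution₂`, `IsKatzMeasure₂`, `IsLMeasure`, `thmII414_exists_lMeasure`);
namespace of the sibling files (`Literature.NumberTheory.EllipticCurves`, grouping sub-namespace `DeShalit1987`).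
Port P54 of the kernel-checked junction of cell `bsd-print-cf2` (crux `SplitBadTwoLowerHalfOfFacts`, STUB-PLAN
v7.6 row 122); generic `p`. All PROVED; 0 named facts; nothing here is about BSD.

* §1 `katzObjectInv μ … l …` — THE Katz object of record of a bounded distribution `μ` on `Γ_K`: the two-variable
  Amice transform of the `(−1)`-reflected push-forward of the `l`-twisted measure along `σ ↦ (κ₁σ, κ₂σ)` (verbatim
  the witness inside `IsKatzDistribution₂.isKatzMeasure₂_amice₂Int_inv` ∘ `katzDistribution₂`).
* §2 `hasValueAt₂_katzObjectInv` — for EVERY bounded `μ` and every rank-one `r` through the pair the object takes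
  at `(r(γ₁⁻¹) − 1, r(γ₂⁻¹) − 1)` the value `∫_{Γ_K} r·l dμ`: (52)–(54) read BEYOND the cone `0 ≤ j < m` of
  `IsKatzMeasure₂` (how Rubin 1991 §4 uses Katz's measure at finite-order points).
* §3 `isKatzMeasure₂_katzObjectInv` (under `IsLMeasure` the object IS a Katz `λ`-frame at `(γ₁⁻¹, γ₂⁻¹)` — the
  tree's two theorems composed, named once), `katzValueExists_of_witness`.
* §4 the same at FACT level through GLUE PREDICATES with explicit binders (receptacles a consumer instantiates;
  nothing is asserted about them): `LMeasureFactWith ι v v̄ Extra` (= the instance body of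
  `thmII414_exists_lMeasure` with a conjunct `Extra S 𝒰 μ` on the SAME witness; `Extra := ⊤` is Thm. 4.14),
  `FrameData`, `MeasureValue … Extra r l P` («for every witness at `Sθ` carrying `Extra`, `P (∫ r·l dμ)`»), the
  `∃`-keyed `MeasureValueWitness`; glue `katzValueExists_of_cut` / `_of_thmII414` / `_of_measureValueWitness`,
  `measureValueWitness_of_cut`, monotonicity in `Extra` / `P`, non-vacuity `not_measureValue_false`.

References: [deShalit1987] II.4.12 (p. 66–67), II Thm. 4.14 (36) (p. 71), II.4.16 (49)–(50) (p. 76–77), II.4.17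
(52)–(54) (p. 77–78), II.5.2 (p. 79); [Rubin1991] §4. (The `p = 2` instance lives under `Summits/…/Theorems/`.)
-/

set_option autoImplicit false

noncomputable section

open NumberField IsDedekindDomain Field
open Literature.NumberTheory.GaloisRepresentations

namespace Literature.NumberTheory.EllipticCurves

namespace DeShalit1987

variable {p : ℕ} [Fact p.Prime] {K : Type} [Field K] [NumberField K]

/-! ## §1 The Katz object of record attached to a bounded distribution -/

section Object

variable {𝒰 : SubgroupTower (absoluteGaloisGroup K)} {κ₁ κ₂ : ZpExtension K p}

/-- **The Katz object of record at the inverse generators**, `G₂(μ, l) ∈ 𝒪_{ℂ_p}⟦T₁⟧⟦T₂⟧`: the two-variable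
Amice transform of the `(−1)`-REFLECTED push-forward `π_*(l·μ)·(−1)` of the `l`-twisted distribution along
`σ ↦ (κ₁σ, κ₂σ)` (the witness inside `IsKatzDistribution₂.isKatzMeasure₂_amice₂Int_inv` ∘ `katzDistribution₂`);
no `IsLMeasure` hypothesis enters the DEFINITION. "`π_*(λ̂⁻¹μ(𝔣))`" (49); "`G(χ; T₁, T₂)`" (53)–(54).
[cite: deShalit1987, II.4.16 (49) (p. 76), II.4.17 (53)–(54) (p. 77–78)] -/
def katzObjectInv (μ : GroupDistribution 𝒰 ℂ_[p]) (hb : μ.bound ≤ 1)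
    (hpc : 𝒰.IsTowerContinuous (ZpExtension.pairCoord κ₁ κ₂))
    (l : FramedGaloisRep K (PadicAlgCl p) 1) (hl : 𝒰.IsTowerContinuous (fun σ ↦ avatarValueAt l σ)) :
    PowerSeries (PowerSeries (PadicComplexInt p)) :=
  ((katzDistribution₂ μ hpc l hl).linearMap (-1) 0 0 (-1)).amice₂Int
    (BoundedDistribution.linearMap_neg_one_bound_le ((katzDistribution₂_bound μ hpc l hl).le.trans hb))

/-! ## §2 The value of the object at ANY pair-point is the Galois integral -/

/-- **Value transport (kernel).** For every bounded distribution `μ` on `Γ_K` along `𝒰`, every tower-continuous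
`l`, every generator pair `(γ₁, γ₂)` of `(κ₁, κ₂)` and EVERY rank-one `r` through the pair — no range / type /
`L`-function hypothesis — the object takes at `(r(γ₁⁻¹) − 1, r(γ₂⁻¹) − 1)` the value `∫_{Γ_K} r(σ)·l(σ) dμ(σ)`.
Proof = II.4.17 (52)–(54) beyond the cone: the descent `F = pairChar` of `r` through the `(−1)`-twisted pair
is a continuous character of `ℤ_p²`, `hasValueAt₂_amice₂Int` evaluates the transform at it, and `F∘(−1)` is the
descent of `r` through `(κ₁, κ₂)`, so `integral_katzDistribution₂` yields `∫ r·l dμ` (the reflection is consumed once).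
[cite: deShalit1987, II.4.17 (52)–(54) (p. 77–78)] -/
theorem hasValueAt₂_katzObjectInv (μ : GroupDistribution 𝒰 ℂ_[p]) (hb : μ.bound ≤ 1)
    (hpc : 𝒰.IsTowerContinuous (ZpExtension.pairCoord κ₁ κ₂))
    (l : FramedGaloisRep K (PadicAlgCl p) 1) (hl : 𝒰.IsTowerContinuous (fun σ ↦ avatarValueAt l σ))
    {γ₁ γ₂ : absoluteGaloisGroup K} (hγ : ZpExtension.IsTopGeneratorPair κ₁ κ₂ γ₁ γ₂)
    {r : FramedGaloisRep K (PadicAlgCl p) 1} (hκ : FactorsThroughPair κ₁ κ₂ r) :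
    IntSeries.HasValueAt₂ (katzObjectInv μ hb hpc l hl) (avatarValueAt r γ₁⁻¹ - 1) (avatarValueAt r γ₂⁻¹ - 1)
      (μ.integral fun σ ↦ avatarValueAt r σ * avatarValueAt l σ) := by
  -- the `(−1)`-twisted pair, its generator pair `(γ₁⁻¹, γ₂⁻¹)`, and the descent of `r` through it
  have hγ' := hγ.unitTwist_neg_one_inv
  have h' : (κ₁.unitTwist (-1)).IsIndependent (κ₂.unitTwist (-1)) := hγ'.isIndependent
  have h : κ₁.IsIndependent κ₂ := hγ.isIndependent
  have hκ' : FactorsThroughPair (κ₁.unitTwist (-1)) (κ₂.unitTwist (-1)) r :=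
    (ZpExtension.factorsThroughPair_unitTwist_iff (-1) (-1) r).mpr hκ
  have hD : (katzDistribution₂ μ hpc l hl).bound ≤ 1 := (katzDistribution₂_bound μ hpc l hl).le.trans hb
  have hFc : IsContinuousChar₂ (ZpExtension.pairChar h' r) := ZpExtension.isContinuousChar₂_pairChar hκ' hγ' h'
  -- character evaluation of the Amice transform of the reflected distribution
  have hval := ((katzDistribution₂ μ hpc l hl).linearMap (-1) 0 0 (-1)).hasValueAt₂_amice₂Int
    (BoundedDistribution.linearMap_neg_one_bound_le hD) hFc
  rw [ZpExtension.pairChar_one_zero hκ' hγ' h', ZpExtension.pairChar_zero_one hκ' hγ' h'] at hval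
  -- `F ∘ (−1)` is the descent of `r` through the ORIGINAL pair
  have hFneg : ∀ σ, (ZpExtension.pairChar h' r ∘ linMap (-1) 0 0 (-1)) (ZpExtension.pairCoord κ₁ κ₂ σ) =
      avatarValueAt r σ := by
    intro σ
    have hFσ : ZpExtension.pairChar h' r (ZpExtension.pairCoord (κ₁.unitTwist (-1)) (κ₂.unitTwist (-1)) σ) =
        avatarValueAt r σ := ZpExtension.pairChar_pairCoord h' hκ' σ
    rw [Function.comp_apply, ← hFσ, ZpExtension.pairCoord_unitTwist_neg_one, linMap_apply,
      ZpExtension.pairCoord_apply]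
    simp only [neg_mul, one_mul, zero_mul, add_zero, zero_add, Prod.neg_mk]
  have hFeq : ZpExtension.pairChar h' r ∘ linMap (-1) 0 0 (-1) = ZpExtension.pairChar h r :=
    ZpExtension.eq_pairChar_of_forall_apply_pairCoord h hκ hFneg
  have hFuc : UniformContinuous (ZpExtension.pairChar h' r) :=
    CompactSpace.uniformContinuous_of_continuous hFc.continuous
  have hGc : UniformContinuous (ZpExtension.pairChar h r) :=
    CompactSpace.uniformContinuous_of_continuous (ZpExtension.continuous_pairChar h hκ)
  have hG1 : ∀ x, ‖ZpExtension.pairChar h r x‖ ≤ 1 := fun x ↦ by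
    obtain ⟨σ, rfl⟩ := ZpExtension.pairCoord_surjective h x
    rw [ZpExtension.pairChar_pairCoord h hκ]
    exact (norm_avatarValueAt_eq_one r σ).le
  -- `∫ F d(D·(−1)) = ∫ F∘(−1) dD = ∫ pairChar dπ_*(l·μ) = ∫ r·l dμ`
  have hint : ((katzDistribution₂ μ hpc l hl).linearMap (-1) 0 0 (-1)).integral (ZpExtension.pairChar h' r) =
      μ.integral (fun σ ↦ avatarValueAt r σ * avatarValueAt l σ) := by
    rw [(katzDistribution₂ μ hpc l hl).integral_linearMap (-1) 0 0 (-1) hFuc, hFeq,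
      integral_katzDistribution₂ μ hpc l hl hGc hG1]
    exact μ.integral_congr fun σ ↦ by rw [ZpExtension.pairChar_pairCoord h hκ]
  rw [hint] at hval
  exact hval

/-- **The consumer's value IS the Galois integral** (values of a convergent two-variable series are
unique): whatever value a downstream argument attaches to the object of record at the point, it equals
`∫ r·l dμ`. [cite: deShalit1987, II.4.17 (52)–(54) (p. 77–78)] -/
theorem value_eq_integral_katzObjectInv (μ : GroupDistribution 𝒰 ℂ_[p]) (hb : μ.bound ≤ 1)
    (hpc : 𝒰.IsTowerContinuous (ZpExtension.pairCoord κ₁ κ₂))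
    (l : FramedGaloisRep K (PadicAlgCl p) 1) (hl : 𝒰.IsTowerContinuous (fun σ ↦ avatarValueAt l σ))
    {γ₁ γ₂ : absoluteGaloisGroup K} (hγ : ZpExtension.IsTopGeneratorPair κ₁ κ₂ γ₁ γ₂)
    {r : FramedGaloisRep K (PadicAlgCl p) 1} (hκ : FactorsThroughPair κ₁ κ₂ r) {val : ℂ_[p]}
    (hv : IntSeries.HasValueAt₂ (katzObjectInv μ hb hpc l hl) (avatarValueAt r γ₁⁻¹ - 1)
      (avatarValueAt r γ₂⁻¹ - 1) val) :
    val = μ.integral fun σ ↦ avatarValueAt r σ * avatarValueAt l σ :=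
  hv.unique (hasValueAt₂_katzObjectInv μ hb hpc l hl hγ hκ)

omit [NumberField K] in
/-- **The integrand `r·l` is the avatar of the PRODUCT character**: `r(σ)·l(σ) = (r ⊗ det l)(σ)`, so
`∫ r·l dμ = ∫ ê dμ` with `e := r ⊗ det l` (by `avatarValueAt_twist_detChar`; with `IsPAdicAvatarOf.mul_twist_outside`,
`e` is the avatar outside `S` of `ε = λρ` — the twist `λ̂⁻¹μ` of (49)). [cite: deShalit1987, II.4.16 (49) (p. 76)] -/
theorem integral_mul_eq_integral_twist (μ : GroupDistribution 𝒰 ℂ_[p])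
    (r l : FramedGaloisRep K (PadicAlgCl p) 1) :
    (μ.integral fun σ ↦ avatarValueAt r σ * avatarValueAt l σ) =
      μ.integral fun σ ↦ avatarValueAt (FramedRep.twist r (detChar l)) σ :=
  μ.integral_congr fun σ ↦ by rw [avatarValueAt_twist_detChar, mul_comm]

end Object

/-! ## §3 Under `IsLMeasure` the object is a Katz `λ`-frame; the witness-level glue -/

section Witness

variable {ι : PadicAlgCl p ≃+* ℂ} {v vbar : HeightOneSpectrum (𝓞 K)} {S : Finset (HeightOneSpectrum (𝓞 K))}
  {Ω δ : ℂ} {Ωp : ℂ_[p]} {𝒰 : SubgroupTower (absoluteGaloisGroup K)} {μ : GroupDistribution 𝒰 ℂ_[p]}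
  {κ₁ κ₂ : ZpExtension K p} {γ₁ γ₂ : absoluteGaloisGroup K}
  {lam : HeckeCharacter K} {l r : FramedGaloisRep K (PadicAlgCl p) 1}

/-- **The object of record of an `IsLMeasure` witness IS a Katz `λ`-frame at `(γ₁⁻¹, γ₂⁻¹)`** (the tree's
`IsLMeasure.isKatzDistribution₂` ∘ `IsKatzDistribution₂.isKatzMeasure₂_amice₂Int_inv`, named once): (49)–(50) on
`Γ_K` along open `𝒰` with `⋂ U_n ⊆ Gal(K̄/K(𝔣p^∞))`, an avatar `l` of `λ` outside `S`, `λ` unramified off `S ∪ {w ∣ p}`.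
[cite: deShalit1987, II.4.16 (49)–(50) (p. 76–77), II.4.17 (54) (p. 78)] -/
theorem isKatzMeasure₂_katzObjectInv (hμ : IsLMeasure ι v vbar S Ω δ Ωp 𝒰 μ)
    (hU : ∀ n, IsOpen (𝒰.U n : Set (absoluteGaloisGroup K)))
    (hN : ⋂ n, (𝒰.U n : Set (absoluteGaloisGroup K)) ⊆ rayKer K p S)
    (hvbar : ((p : ℕ) : 𝓞 K) ∈ vbar.asIdeal) (hb : μ.bound ≤ 1) (hl : IsPAdicAvatarOutside S ι lam l)
    (hlam : ∀ w : HeightOneSpectrum (𝓞 K), w ∉ S → ((p : ℕ) : 𝓞 K) ∉ w.asIdeal → lam.IsUnramifiedAt w)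
    (hγ : ZpExtension.IsTopGeneratorPair κ₁ κ₂ γ₁ γ₂) :
    IsKatzMeasure₂ ι v vbar S κ₁ κ₂ γ₁⁻¹ γ₂⁻¹ lam Ω δ Ωp
      (katzObjectInv μ hb (isTowerContinuous_pairCoord κ₁ κ₂ hU hN) l
        (isTowerContinuous_avatarValueAt hl hlam hU hN)) :=
  (hμ.isKatzDistribution₂ hU hN hvbar hl hlam hγ.isIndependent).isKatzMeasure₂_amice₂Int_inv
    ((katzDistribution₂_bound μ _ l _).le.trans hb) hγ

/-- **Glue, witness level.** For ANY predicate `P` on `ℂ_p`: if the Galois integral `∫ r·l dμ` of an `IsLMeasure`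
witness satisfies `P`, then SOME Katz `λ`-frame at `(γ₁⁻¹, γ₂⁻¹)` (the object of record) has at
`(r(γ₁⁻¹) − 1, r(γ₂⁻¹) − 1)` SOME value (the integral) satisfying `P`.
[cite: deShalit1987, II.4.16 (49)–(50) (p. 76–77), II.4.17 (52)–(54) (p. 77–78)] -/
theorem katzValueExists_of_witness {P : ℂ_[p] → Prop}
    (hμ : IsLMeasure ι v vbar S Ω δ Ωp 𝒰 μ)
    (hU : ∀ n, IsOpen (𝒰.U n : Set (absoluteGaloisGroup K)))
    (hN : ⋂ n, (𝒰.U n : Set (absoluteGaloisGroup K)) ⊆ rayKer K p S)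
    (hvbar : ((p : ℕ) : 𝓞 K) ∈ vbar.asIdeal) (hb : μ.bound ≤ 1) (hl : IsPAdicAvatarOutside S ι lam l)
    (hlam : ∀ w : HeightOneSpectrum (𝓞 K), w ∉ S → ((p : ℕ) : 𝓞 K) ∉ w.asIdeal → lam.IsUnramifiedAt w)
    (hγ : ZpExtension.IsTopGeneratorPair κ₁ κ₂ γ₁ γ₂) (hκ : FactorsThroughPair κ₁ κ₂ r)
    (hval : P (μ.integral fun σ ↦ avatarValueAt r σ * avatarValueAt l σ)) :
    ∃ G₂ : PowerSeries (PowerSeries (PadicComplexInt p)),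
      IsKatzMeasure₂ ι v vbar S κ₁ κ₂ γ₁⁻¹ γ₂⁻¹ lam Ω δ Ωp G₂ ∧
      ∃ val : ℂ_[p], IntSeries.HasValueAt₂ G₂ (avatarValueAt r γ₁⁻¹ - 1) (avatarValueAt r γ₂⁻¹ - 1) val ∧ P val :=
  ⟨_, isKatzMeasure₂_katzObjectInv hμ hU hN hvbar hb hl hlam hγ, _,
    hasValueAt₂_katzObjectInv μ hb _ l _ hγ hκ, hval⟩

end Witness

/-! ## §4 The same at FACT level: fact shape (with an extra conjunct) ∧ frame data ∧ value ⟹ Katz value -/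

section Fact

variable {ι : PadicAlgCl p ≃+* ℂ} {v vbar : HeightOneSpectrum (𝓞 K)} {Sθ : Finset (HeightOneSpectrum (𝓞 K))}
  {κ₁ κ₂ : ZpExtension K p} {γ₁ γ₂ : absoluteGaloisGroup K}
  {lam : HeckeCharacter K} {l r : FramedGaloisRep K (PadicAlgCl p) 1}

/-- **Glue predicate 1 — the SHAPE of Thm. 4.14 (measure currency) at `(p, K, ι, v, v̄)` with an extra conjunct
on the witness**: verbatim the instance body of `thmII414_exists_lMeasure` with `∧ Extra S 𝒰 μ` appended inside
the inner existential. `Extra := ⊤` is Thm. 4.14 (`lMeasureFactWith_true_of_thmII414`); a stronger `Extra` (e.g.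
the coset values of II.5.2 (4)) is a strengthened reading ON THE SAME witness. A receptacle with explicit binders —
nothing is asserted. [cite: deShalit1987, II Thm. 4.14 (36) (p. 71), II.4.12 Remark (i) (p. 66–67), II.4.16 (49)–(50) (p. 76–77)] -/
def LMeasureFactWith (ι : PadicAlgCl p ≃+* ℂ) (v vbar : HeightOneSpectrum (𝓞 K))
    (Extra : Finset (HeightOneSpectrum (𝓞 K)) → (𝒰 : SubgroupTower (absoluteGaloisGroup K)) →
      GroupDistribution 𝒰 ℂ_[p] → Prop) : Prop :=
  ∃ (Ω δ : ℂ) (Ωp : (unrIntegers p)ˣ), Ω ≠ 0 ∧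
    (δ ^ 2 = (NumberField.discr K : ℂ) ∨ δ ^ 2 = -(NumberField.discr K : ℂ)) ∧
    ∀ (S : Finset (HeightOneSpectrum (𝓞 K))), v ∉ S → vbar ∉ S →
      ∃ (𝒰 : SubgroupTower (absoluteGaloisGroup K)) (μ : GroupDistribution 𝒰 ℂ_[p]),
        (∀ n, IsOpen (𝒰.U n : Set (absoluteGaloisGroup K))) ∧
        (⋂ n, (𝒰.U n : Set (absoluteGaloisGroup K))) ⊆ rayKer K p S ∧
        μ.bound ≤ 1 ∧
        IsLMeasure ι v vbar S Ω δ ((Ωp : unrIntegers p) : ℂ_[p]) 𝒰 μ ∧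
        Extra S 𝒰 μ

/-- **Thm. 4.14 (the named fact `thmII414_exists_lMeasure`) gives the shape with `Extra := ⊤`.**
[cite: deShalit1987, II Thm. 4.14 (36) (p. 71)] -/
theorem lMeasureFactWith_true_of_thmII414 (hA : thmII414_exists_lMeasure)
    (hK : IsImaginaryQuadratic K) (ι : PadicAlgCl p ≃+* ℂ) (v vbar : HeightOneSpectrum (𝓞 K))
    (hv : ((p : ℕ) : 𝓞 K) ∈ v.asIdeal) (hvbar : ((p : ℕ) : 𝓞 K) ∈ vbar.asIdeal) (hne : vbar ≠ v)
    (hι : ∀ (w : InfinitePlace K) (k : 𝓞 K), k ∈ v.asIdeal ↔ ‖ι.symm (w.embedding (k : K))‖ < 1) :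
    LMeasureFactWith ι v vbar (fun _ _ _ ↦ True) := by
  obtain ⟨Ω, δ, Ωp, hΩ, hδ, hS⟩ := hA p K hK ι v vbar hv hvbar hne hι
  refine ⟨Ω, δ, Ωp, hΩ, hδ, fun S hvS hvbarS ↦ ?_⟩
  obtain ⟨𝒰, μ, h1, h2, h3, h4⟩ := hS S hvS hvbarS
  exact ⟨𝒰, μ, h1, h2, h3, h4, trivial⟩

/-- **The shape of Thm. 4.14 is MONOTONE in the extra conjunct `Extra`** (in particular any `Extra` gives the
`Extra := ⊤` shape = Thm. 4.14 at `(p, K, ι, v, v̄)`). [cite: deShalit1987, II Thm. 4.14 (36) (p. 71)] -/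
theorem lMeasureFactWith_mono
    {Extra Extra' : Finset (HeightOneSpectrum (𝓞 K)) → (𝒰 : SubgroupTower (absoluteGaloisGroup K)) →
      GroupDistribution 𝒰 ℂ_[p] → Prop}
    (hE : ∀ S 𝒰 μ, Extra S 𝒰 μ → Extra' S 𝒰 μ) (h : LMeasureFactWith ι v vbar Extra) :
    LMeasureFactWith ι v vbar Extra' := by
  obtain ⟨Ω, δ, Ωp, hΩ, hδ, hS⟩ := h
  refine ⟨Ω, δ, Ωp, hΩ, hδ, fun S hvS hvbarS ↦ ?_⟩
  obtain ⟨𝒰, μ, h1, h2, h3, h4, h5⟩ := hS S hvS hvbarS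
  exact ⟨𝒰, μ, h1, h2, h3, h4, hE S 𝒰 μ h5⟩

/-- **Glue predicate 3 — THE VALUE IN MEASURE CURRENCY.** For EVERY admissible period triple and EVERY
witness `(𝒰, μ)` of the shape at the tame set `Sθ` carrying `Extra`, the Galois integral of `r·l` satisfies
`P`. `∀`-keyed over witnesses: NO uniqueness of de Shalit's measure is consumed; whatever more a producer
needs about `μ` must be put into `Extra`. A receptacle with explicit binders — nothing is asserted.
[cite: deShalit1987, II.4.16 (49)–(50) (p. 76–77), II.5.2 (p. 79)] -/
def MeasureValue (ι : PadicAlgCl p ≃+* ℂ) (v vbar : HeightOneSpectrum (𝓞 K)) (Sθ : Finset (HeightOneSpectrum (𝓞 K)))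
    (Extra : Finset (HeightOneSpectrum (𝓞 K)) → (𝒰 : SubgroupTower (absoluteGaloisGroup K)) →
      GroupDistribution 𝒰 ℂ_[p] → Prop)
    (r l : FramedGaloisRep K (PadicAlgCl p) 1) (P : ℂ_[p] → Prop) : Prop :=
  ∀ (Ω δ : ℂ) (Ωp : (unrIntegers p)ˣ) (𝒰 : SubgroupTower (absoluteGaloisGroup K)) (μ : GroupDistribution 𝒰 ℂ_[p]),
    (∀ n, IsOpen (𝒰.U n : Set (absoluteGaloisGroup K))) →
    (⋂ n, (𝒰.U n : Set (absoluteGaloisGroup K))) ⊆ rayKer K p Sθ → μ.bound ≤ 1 →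
    IsLMeasure ι v vbar Sθ Ω δ ((Ωp : unrIntegers p) : ℂ_[p]) 𝒰 μ → Extra Sθ 𝒰 μ →
    P (μ.integral fun σ ↦ avatarValueAt r σ * avatarValueAt l σ)

/-- `MeasureValue` is ANTITONE in `Extra` (a stronger conjunct on the witness of Thm. 4.14 makes the value
clause weaker to prove). [cite: deShalit1987, II Thm. 4.14 (36) (p. 71), II.4.16 (49)–(50) (p. 76–77)] -/
theorem measureValue_anti
    {Extra Extra' : Finset (HeightOneSpectrum (𝓞 K)) → (𝒰 : SubgroupTower (absoluteGaloisGroup K)) →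
      GroupDistribution 𝒰 ℂ_[p] → Prop} {P : ℂ_[p] → Prop}
    (hE : ∀ S 𝒰 μ, Extra' S 𝒰 μ → Extra S 𝒰 μ) (h : MeasureValue ι v vbar Sθ Extra r l P) :
    MeasureValue ι v vbar Sθ Extra' r l P :=
  fun Ω δ Ωp 𝒰 μ hU hN hb hμ hx ↦ h Ω δ Ωp 𝒰 μ hU hN hb hμ (hE Sθ 𝒰 μ hx)

/-- `MeasureValue` is MONOTONE in the value predicate `P` (e.g. `‖·‖ = c` ⟹ `‖·‖ ≤ c`).
[cite: deShalit1987, II.4.16 (49)–(50) (p. 76–77)] -/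
theorem measureValue_mono_right
    {Extra : Finset (HeightOneSpectrum (𝓞 K)) → (𝒰 : SubgroupTower (absoluteGaloisGroup K)) →
      GroupDistribution 𝒰 ℂ_[p] → Prop} {P Q : ℂ_[p] → Prop}
    (hPQ : ∀ z, P z → Q z) (h : MeasureValue ι v vbar Sθ Extra r l P) :
    MeasureValue ι v vbar Sθ Extra r l Q :=
  fun Ω δ Ωp 𝒰 μ hU hN hb hμ hx ↦ hPQ _ (h Ω δ Ωp 𝒰 μ hU hN hb hμ hx)

/-- **Glue predicate 2 — the FRAME DATA at the tame set** (the data of II.4.12 / II.4.17's frame): `v, v̄ ∉ Sθ`,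
`l` is an avatar of `λ` outside `Sθ`, `λ` is unramified outside `Sθ ∪ {v, v̄}`, `(γ₁, γ₂)` generates `(κ₁, κ₂)`,
`r` factors through the pair. A receptacle — nothing is asserted. [cite: deShalit1987, II.4.12 (p. 66–67), II.4.17 (52) (p. 77)] -/
def FrameData (ι : PadicAlgCl p ≃+* ℂ) (v vbar : HeightOneSpectrum (𝓞 K)) (Sθ : Finset (HeightOneSpectrum (𝓞 K)))
    (κ₁ κ₂ : ZpExtension K p) (γ₁ γ₂ : absoluteGaloisGroup K) (lam : HeckeCharacter K)
    (l r : FramedGaloisRep K (PadicAlgCl p) 1) : Prop :=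
  v ∉ Sθ ∧ vbar ∉ Sθ ∧ IsPAdicAvatarOutside Sθ ι lam l ∧
    (∀ w : HeightOneSpectrum (𝓞 K), w ∉ Sθ → w ≠ v → w ≠ vbar → lam.IsUnramifiedAt w) ∧
    ZpExtension.IsTopGeneratorPair κ₁ κ₂ γ₁ γ₂ ∧ FactorsThroughPair κ₁ κ₂ r

omit [Fact p.Prime] in
/-- `λ` unramified off `Sθ ∪ {v, v̄}`, `v, v̄ ∣ p` ⟹ `λ` unramified off `Sθ ∪ {w ∣ p}`. [folklore] -/
private theorem isUnramifiedAt_of_frame (hv : ((p : ℕ) : 𝓞 K) ∈ v.asIdeal) (hvbar : ((p : ℕ) : 𝓞 K) ∈ vbar.asIdeal)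
    (hlam : ∀ w : HeightOneSpectrum (𝓞 K), w ∉ Sθ → w ≠ v → w ≠ vbar → lam.IsUnramifiedAt w)
    (w : HeightOneSpectrum (𝓞 K)) (hwS : w ∉ Sθ) (hwp : ((p : ℕ) : 𝓞 K) ∉ w.asIdeal) : lam.IsUnramifiedAt w :=
  hlam w hwS (fun h ↦ hwp (h ▸ hv)) (fun h ↦ hwp (h ▸ hvbar))

/-- **THE GLUE OF THE CUT: shape (any `Extra`) ∧ `v, v̄ ∣ p` ∧ frame data ∧ value ⟹ Katz value**, in the
consumer's currency (`Ω ≠ 0`, `δ² = ±d_K`, `Ω_p ∈ (𝒪^{unr})ˣ`, `IsKatzMeasure₂` of the `λ`-frame at the inverse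
generators, a value at `(r(γ₁⁻¹) − 1, r(γ₂⁻¹) − 1)` satisfying `P`). The proof runs §3 on the shape's witness at
`S = Sθ`. [cite: deShalit1987, II Thm. 4.14 (36) (p. 71), II.4.17 (52)–(54) (p. 77–78)] -/
theorem katzValueExists_of_cut
    {Extra : Finset (HeightOneSpectrum (𝓞 K)) → (𝒰 : SubgroupTower (absoluteGaloisGroup K)) →
      GroupDistribution 𝒰 ℂ_[p] → Prop} {P : ℂ_[p] → Prop}
    (hfact : LMeasureFactWith ι v vbar Extra)
    (hv : ((p : ℕ) : 𝓞 K) ∈ v.asIdeal) (hvbar : ((p : ℕ) : 𝓞 K) ∈ vbar.asIdeal)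
    (hframe : FrameData ι v vbar Sθ κ₁ κ₂ γ₁ γ₂ lam l r)
    (hval : MeasureValue ι v vbar Sθ Extra r l P) :
    ∃ (Ω δ : ℂ) (Ωp : (unrIntegers p)ˣ) (G₂ : PowerSeries (PowerSeries (PadicComplexInt p))),
      Ω ≠ 0 ∧ (δ ^ 2 = (NumberField.discr K : ℂ) ∨ δ ^ 2 = -(NumberField.discr K : ℂ)) ∧
      IsKatzMeasure₂ ι v vbar Sθ κ₁ κ₂ γ₁⁻¹ γ₂⁻¹ lam Ω δ ((Ωp : unrIntegers p) : ℂ_[p]) G₂ ∧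
      ∃ val : ℂ_[p], IntSeries.HasValueAt₂ G₂ (avatarValueAt r γ₁⁻¹ - 1) (avatarValueAt r γ₂⁻¹ - 1) val ∧
        P val := by
  obtain ⟨hvS, hvbarS, hl, hlam, hγ, hκ⟩ := hframe
  obtain ⟨Ω, δ, Ωp, hΩ, hδ, hS⟩ := hfact
  obtain ⟨𝒰, μ, hU, hN, hb, hμ, hE⟩ := hS Sθ hvS hvbarS
  obtain ⟨G₂, hG₂, val, hvalG, hP⟩ := katzValueExists_of_witness hμ hU hN hvbar hb hl
    (isUnramifiedAt_of_frame hv hvbar hlam) hγ hκ (hval Ω δ Ωp 𝒰 μ hU hN hb hμ hE)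
  exact ⟨Ω, δ, Ωp, G₂, hΩ, hδ, hG₂, val, hvalG, hP⟩

/-- **Thm. 4.14 as it stands ∧ frame data ∧ value (`Extra := ⊤`) ⟹ Katz value.**
[cite: deShalit1987, II Thm. 4.14 (36) (p. 71), II.4.17 (52)–(54) (p. 77–78)] -/
theorem katzValueExists_of_thmII414 {P : ℂ_[p] → Prop}
    (hA : thmII414_exists_lMeasure) (hK : IsImaginaryQuadratic K)
    (hv : ((p : ℕ) : 𝓞 K) ∈ v.asIdeal) (hvbar : ((p : ℕ) : 𝓞 K) ∈ vbar.asIdeal) (hne : vbar ≠ v)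
    (hι : ∀ (w : InfinitePlace K) (k : 𝓞 K), k ∈ v.asIdeal ↔ ‖ι.symm (w.embedding (k : K))‖ < 1)
    (hframe : FrameData ι v vbar Sθ κ₁ κ₂ γ₁ γ₂ lam l r)
    (hval : MeasureValue ι v vbar Sθ (fun _ _ _ ↦ True) r l P) :
    ∃ (Ω δ : ℂ) (Ωp : (unrIntegers p)ˣ) (G₂ : PowerSeries (PowerSeries (PadicComplexInt p))),
      Ω ≠ 0 ∧ (δ ^ 2 = (NumberField.discr K : ℂ) ∨ δ ^ 2 = -(NumberField.discr K : ℂ)) ∧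
      IsKatzMeasure₂ ι v vbar Sθ κ₁ κ₂ γ₁⁻¹ γ₂⁻¹ lam Ω δ ((Ωp : unrIntegers p) : ℂ_[p]) G₂ ∧
      ∃ val : ℂ_[p], IntSeries.HasValueAt₂ G₂ (avatarValueAt r γ₁⁻¹ - 1) (avatarValueAt r γ₂⁻¹ - 1) val ∧
        P val :=
  katzValueExists_of_cut (lMeasureFactWith_true_of_thmII414 hA hK ι v vbar hv hvbar hne hι) hv hvbar hframe hval

/-- **`MeasureValue` is not vacuous** whenever the shape of Thm. 4.14 holds and `v, v̄ ∉ Sθ`: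
`MeasureValue … (fun _ ↦ False)` is refutable. [cite: deShalit1987, II Thm. 4.14 (36) (p. 71)] -/
theorem not_measureValue_false
    {Extra : Finset (HeightOneSpectrum (𝓞 K)) → (𝒰 : SubgroupTower (absoluteGaloisGroup K)) →
      GroupDistribution 𝒰 ℂ_[p] → Prop}
    (hfact : LMeasureFactWith ι v vbar Extra) (hvS : v ∉ Sθ) (hvbarS : vbar ∉ Sθ)
    (r l : FramedGaloisRep K (PadicAlgCl p) 1) :
    ¬ MeasureValue ι v vbar Sθ Extra r l (fun _ ↦ False) := by
  intro h
  obtain ⟨Ω, δ, Ωp, -, -, hS⟩ := hfact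
  obtain ⟨𝒰, μ, hU, hN, hb, hμ, hE⟩ := hS Sθ hvS hvbarS
  exact h Ω δ Ωp 𝒰 μ hU hN hb hμ hE

end Fact

/-! ## §4b The weakest residual: ONE witness (`∃`-keyed) — no fact hypothesis at all -/

section Exists

variable {ι : PadicAlgCl p ≃+* ℂ} {v vbar : HeightOneSpectrum (𝓞 K)} {Sθ : Finset (HeightOneSpectrum (𝓞 K))}
  {κ₁ κ₂ : ZpExtension K p} {γ₁ γ₂ : absoluteGaloisGroup K}
  {lam : HeckeCharacter K} {l r : FramedGaloisRep K (PadicAlgCl p) 1}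

/-- **Glue predicate 4 — ONE WITNESS**: SOME admissible period triple and SOME `IsLMeasure` witness `(𝒰, μ)`
at the tame set `Sθ` whose Galois integral of `r·l` satisfies `P`. With the frame data this ALONE gives a
Katz value (`katzValueExists_of_measureValueWitness`); the `∀`-keyed `MeasureValue` together with the shape
is one way to produce it (`measureValueWitness_of_cut`). A receptacle — nothing is asserted.
[cite: deShalit1987, II.4.16 (49)–(50) (p. 76–77)] -/
def MeasureValueWitness (ι : PadicAlgCl p ≃+* ℂ) (v vbar : HeightOneSpectrum (𝓞 K))
    (Sθ : Finset (HeightOneSpectrum (𝓞 K))) (r l : FramedGaloisRep K (PadicAlgCl p) 1)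
    (P : ℂ_[p] → Prop) : Prop :=
  ∃ (Ω δ : ℂ) (Ωp : (unrIntegers p)ˣ) (𝒰 : SubgroupTower (absoluteGaloisGroup K)) (μ : GroupDistribution 𝒰 ℂ_[p]),
    Ω ≠ 0 ∧ (δ ^ 2 = (NumberField.discr K : ℂ) ∨ δ ^ 2 = -(NumberField.discr K : ℂ)) ∧
    (∀ n, IsOpen (𝒰.U n : Set (absoluteGaloisGroup K))) ∧
    (⋂ n, (𝒰.U n : Set (absoluteGaloisGroup K))) ⊆ rayKer K p Sθ ∧ μ.bound ≤ 1 ∧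
    IsLMeasure ι v vbar Sθ Ω δ ((Ωp : unrIntegers p) : ℂ_[p]) 𝒰 μ ∧
    P (μ.integral fun σ ↦ avatarValueAt r σ * avatarValueAt l σ)

/-- **Glue (`∃` form): `v, v̄ ∣ p` ∧ frame data ∧ ONE witness ⟹ Katz value.**
[cite: deShalit1987, II.4.16 (49)–(50) (p. 76–77), II.4.17 (52)–(54) (p. 77–78)] -/
theorem katzValueExists_of_measureValueWitness {P : ℂ_[p] → Prop}
    (hv : ((p : ℕ) : 𝓞 K) ∈ v.asIdeal) (hvbar : ((p : ℕ) : 𝓞 K) ∈ vbar.asIdeal)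
    (hframe : FrameData ι v vbar Sθ κ₁ κ₂ γ₁ γ₂ lam l r)
    (hW : MeasureValueWitness ι v vbar Sθ r l P) :
    ∃ (Ω δ : ℂ) (Ωp : (unrIntegers p)ˣ) (G₂ : PowerSeries (PowerSeries (PadicComplexInt p))),
      Ω ≠ 0 ∧ (δ ^ 2 = (NumberField.discr K : ℂ) ∨ δ ^ 2 = -(NumberField.discr K : ℂ)) ∧
      IsKatzMeasure₂ ι v vbar Sθ κ₁ κ₂ γ₁⁻¹ γ₂⁻¹ lam Ω δ ((Ωp : unrIntegers p) : ℂ_[p]) G₂ ∧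
      ∃ val : ℂ_[p], IntSeries.HasValueAt₂ G₂ (avatarValueAt r γ₁⁻¹ - 1) (avatarValueAt r γ₂⁻¹ - 1) val ∧
        P val := by
  obtain ⟨-, -, hl, hlam, hγ, hκ⟩ := hframe
  obtain ⟨Ω, δ, Ωp, 𝒰, μ, hΩ, hδ, hU, hN, hb, hμ, hP⟩ := hW
  obtain ⟨G₂, hG₂, val, hvalG, hPv⟩ := katzValueExists_of_witness hμ hU hN hvbar hb hl
    (isUnramifiedAt_of_frame hv hvbar hlam) hγ hκ hP
  exact ⟨Ω, δ, Ωp, G₂, hΩ, hδ, hG₂, val, hvalG, hPv⟩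

/-- **The `∀`-keyed cut produces the witness**: shape of Thm. 4.14 (any `Extra`) ∧ `v, v̄ ∉ Sθ` ∧ `MeasureValue`
⟹ `MeasureValueWitness`. [cite: deShalit1987, II Thm. 4.14 (36) (p. 71)] -/
theorem measureValueWitness_of_cut
    {Extra : Finset (HeightOneSpectrum (𝓞 K)) → (𝒰 : SubgroupTower (absoluteGaloisGroup K)) →
      GroupDistribution 𝒰 ℂ_[p] → Prop} {P : ℂ_[p] → Prop}
    (hfact : LMeasureFactWith ι v vbar Extra) (hvS : v ∉ Sθ) (hvbarS : vbar ∉ Sθ)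
    (hval : MeasureValue ι v vbar Sθ Extra r l P) :
    MeasureValueWitness ι v vbar Sθ r l P := by
  obtain ⟨Ω, δ, Ωp, hΩ, hδ, hS⟩ := hfact
  obtain ⟨𝒰, μ, hU, hN, hb, hμ, hE⟩ := hS Sθ hvS hvbarS
  exact ⟨Ω, δ, Ωp, 𝒰, μ, hΩ, hδ, hU, hN, hb, hμ, hval Ω δ Ωp 𝒰 μ hU hN hb hμ hE⟩

end Exists

end DeShalit1987

end Literature.NumberTheory.EllipticCurves

end
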